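import Summits.Parity.GeneralizedHardyLittlewood.Theorems.TwinLowerDensityToGHLShiftLiftTranslationClass
import Summits.Parity.GeneralizedHardyLittlewood.Theorems.GeneralizedHardyLittlewoodDimOne
import HarnessLib

/-!
# Exact position of the residual of the shift lift `BoundedDickson → DimOne`
(crux `TwinLowerDensityToGHL`, stmt-Parity-18380, line `birth_ParityLeakOneFifth`, stub `stub_shiftLift`)

`Theorems/TwinLowerDensityToGHLShiftLiftTranslationClass.lean` proves the translation-class slice of the registered
stub `stub_shiftLift : BoundedDickson → GeneralizedHardyLittlewoodDimOne` (13151 → 0819).  This file records, in the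
kernel and WITHOUT new definitions, what is then left of the stub — the **off-class residual**

`OffClass :≡ ∀ t L, 1 ≤ t → ∀ ε > 0, ∃ B N₀, ∀ N ≥ N₀, ∀ Ψ non-degenerate with ‖Ψ‖_N ≤ L and NO translate within B`
`(∀ c, ∃ i, |bᵢ − aᵢ c| > B), ∀ convex K ⊆ [−N, N], |∑_K ∏ Λ(ψᵢ n) − β_∞ 𝔖| ≤ ε N`

(written out inline below; the prover of the residual may choose the excluded class width `B = B(t, L, ε)`):

* `offClass_of_dimOne` — `DimOne ⇒ OffClass` (restriction; unconditional);
* `dimOne_of_offClass` — `BoundedDickson ⇒ OffClass ⇒ DimOne` (case split on "translate within `B`": the class is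
  `uniform_translationClass`, the complement is the residual);
* `dimOne_iff_offClass` — under `BoundedDickson`, `DimOne ⟺ OffClass`; hence
* `shiftLift_iff` — `stub_shiftLift ⟺ (BoundedDickson → OffClass)`: the stub IS its off-class residual, exactly
  (the `example` after it kernel-checks that the left side is the registered stub text verbatim).

So the open content of `stub_shiftLift` is precisely shift-uniformity for systems whose constants drift away from every
bounded pattern (some pair discriminant `|aᵢ bⱼ − aⱼ bᵢ| → ∞`: pairs `(n, n + h)` with `h → ∞`, Goldbach `(n, M − n)`),
the binary Siegel-sensitive core of stmt-Parity-0819 (`not_generalizedHardyLittlewoodDimOne_of_unboundedSiegelZeros`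
uses `(n, n + 2q)`, `q → ∞`).  No new definitions. [cite: GreenTao2010, Conj. 1.2 (d = 1) and §1]
-/

open Finset MeasureTheory

namespace Summit.Parity.GeneralizedHardyLittlewood.TwinLowerDensityToGHLShiftLiftTranslationClass

open Literature.NumberTheory.Sieve
open Summit.Parity.GeneralizedHardyLittlewood (GeneralizedHardyLittlewoodDimOne)
open Summit.Parity.GeneralizedHardyLittlewood.Theses.TwinMinorArcs (BoundedDickson)

/-- **`DimOne ⇒` the off-class residual** (restriction of the uniform statement to the off-class systems; any `B`,
here `B = 0`). [cite: GreenTao2010, Conj. 1.2] -/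
theorem offClass_of_dimOne (hD : GeneralizedHardyLittlewoodDimOne) :
    ∀ (t L : ℕ), 1 ≤ t → ∀ ε : ℝ, 0 < ε → ∃ B N₀ : ℕ, ∀ N : ℕ, N₀ ≤ N →
      ∀ Ψ : Fin t → AffLinForm 1, IsNondegenerateSystem Ψ → affLinSize Ψ N ≤ L →
        (∀ c : ℤ, ∃ i, (B : ℤ) < |(Ψ i).const - (Ψ i).coeff 0 * c|) →
        ∀ K : Set (Fin 1 → ℝ), Convex ℝ K → K ⊆ realBox 1 N →
          |vonMangoldtSum Ψ K N - archFactor Ψ K * singularProduct Ψ| ≤ ε * (N : ℝ) := by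
  intro t L ht ε hε
  obtain ⟨N₀, hN₀⟩ := hD t L ht ε hε
  exact ⟨0, N₀, fun N hN Ψ hΨ hL _ K hK hKN => hN₀ N hN Ψ hΨ hL K hK hKN⟩

/-- **`BoundedDickson ⇒` (off-class residual `⇒ DimOne`).**  Given Dickson–Hardy–Littlewood for fixed systems, the
shift-uniform statement `GeneralizedHardyLittlewoodDimOne` (stmt-Parity-0819) follows from its off-class residual:
for `t, L, ε` let `B` be the residual's excluded width; a system with `‖Ψ‖_N ≤ L` either has a translate within `B`
(then `uniform_translationClass`) or has none (then the residual). [cite: GreenTao2010, Conj. 1.2 (d = 1)] -/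
theorem dimOne_of_offClass (hBD : BoundedDickson)
    (hOff : ∀ (t L : ℕ), 1 ≤ t → ∀ ε : ℝ, 0 < ε → ∃ B N₀ : ℕ, ∀ N : ℕ, N₀ ≤ N →
      ∀ Ψ : Fin t → AffLinForm 1, IsNondegenerateSystem Ψ → affLinSize Ψ N ≤ L →
        (∀ c : ℤ, ∃ i, (B : ℤ) < |(Ψ i).const - (Ψ i).coeff 0 * c|) →
        ∀ K : Set (Fin 1 → ℝ), Convex ℝ K → K ⊆ realBox 1 N →
          |vonMangoldtSum Ψ K N - archFactor Ψ K * singularProduct Ψ| ≤ ε * (N : ℝ)) :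
    GeneralizedHardyLittlewoodDimOne := by
  intro t L ht ε hε
  obtain ⟨B, N₁, hN₁⟩ := hOff t L ht ε hε
  obtain ⟨N₂, hN₂⟩ := uniform_translationClass hBD t L B ht ε hε
  refine ⟨max N₁ N₂, fun N hN Ψ hΨ hL K hK hKN => ?_⟩
  by_cases hcl : ∃ c : ℤ, ∀ i, |(Ψ i).const - (Ψ i).coeff 0 * c| ≤ B
  · exact hN₂ N (le_of_max_le_right hN) Ψ hΨ hL hcl K hK hKN
  · push Not at hcl
    exact hN₁ N (le_of_max_le_left hN) Ψ hΨ hL hcl K hK hKN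

/-- **Exact position of the residual.**  Under `BoundedDickson`, the shift-uniform statement
`GeneralizedHardyLittlewoodDimOne` is EQUIVALENT to its off-class residual. [cite: GreenTao2010, Conj. 1.2 (d = 1)] -/
theorem dimOne_iff_offClass (hBD : BoundedDickson) :
    GeneralizedHardyLittlewoodDimOne ↔
      ∀ (t L : ℕ), 1 ≤ t → ∀ ε : ℝ, 0 < ε → ∃ B N₀ : ℕ, ∀ N : ℕ, N₀ ≤ N →
        ∀ Ψ : Fin t → AffLinForm 1, IsNondegenerateSystem Ψ → affLinSize Ψ N ≤ L →
          (∀ c : ℤ, ∃ i, (B : ℤ) < |(Ψ i).const - (Ψ i).coeff 0 * c|) →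
          ∀ K : Set (Fin 1 → ℝ), Convex ℝ K → K ⊆ realBox 1 N →
            |vonMangoldtSum Ψ K N - archFactor Ψ K * singularProduct Ψ| ≤ ε * (N : ℝ) :=
  ⟨offClass_of_dimOne, dimOne_of_offClass hBD⟩

/-- **The stub IS its off-class residual.**  `stub_shiftLift` (`BoundedDickson → GeneralizedHardyLittlewoodDimOne`,
registered on stmt-Parity-18380; also the residual stub of `Cruxes/PairsToGHL/Lines/sloped_ladder.lean` and
`TwinMinorArcs.ResidualLift` (b)) is equivalent to `BoundedDickson →` (off-class residual).
[cite: GreenTao2010, Conj. 1.2 (d = 1)] -/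
theorem shiftLift_iff :
    (BoundedDickson → GeneralizedHardyLittlewoodDimOne) ↔
      (BoundedDickson →
        ∀ (t L : ℕ), 1 ≤ t → ∀ ε : ℝ, 0 < ε → ∃ B N₀ : ℕ, ∀ N : ℕ, N₀ ≤ N →
          ∀ Ψ : Fin t → AffLinForm 1, IsNondegenerateSystem Ψ → affLinSize Ψ N ≤ L →
            (∀ c : ℤ, ∃ i, (B : ℤ) < |(Ψ i).const - (Ψ i).coeff 0 * c|) →
            ∀ K : Set (Fin 1 → ℝ), Convex ℝ K → K ⊆ realBox 1 N →
              |vonMangoldtSum Ψ K N - archFactor Ψ K * singularProduct Ψ| ≤ ε * (N : ℝ)) :=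
  ⟨fun h hBD => (dimOne_iff_offClass hBD).mp (h hBD), fun h hBD => (dimOne_iff_offClass hBD).mpr (h hBD)⟩

/-- Kernel check: the left side of `shiftLift_iff` is the REGISTERED text of `stub_shiftLift` verbatim
(hypothesis = `BoundedDickson` unfolded, conclusion = `GeneralizedHardyLittlewoodDimOne` unfolded). -/
example :
    ((∀ (t : ℕ) (Φ : Fin t → Literature.NumberTheory.Sieve.AffLinForm 1), 1 ≤ t → Literature.NumberTheory.Sieve.IsNondegenerateSystem Φ → ∀ ε : ℝ, 0 < ε → ∃ N₀ : ℕ, ∀ N : ℕ, N₀ ≤ N → ∀ K : Set (Fin 1 → ℝ), Convex ℝ K → K ⊆ Literature.NumberTheory.Sieve.realBox 1 N → |Literature.NumberTheory.Sieve.vonMangoldtSum Φ K N - Literature.NumberTheory.Sieve.archFactor Φ K * Literature.NumberTheory.Sieve.singularProduct Φ| ≤ ε * N) →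
      ∀ (t L : ℕ), 1 ≤ t → ∀ ε : ℝ, 0 < ε → ∃ N₀ : ℕ, ∀ N : ℕ, N₀ ≤ N → ∀ Ψ : Fin t → Literature.NumberTheory.Sieve.AffLinForm 1, Literature.NumberTheory.Sieve.IsNondegenerateSystem Ψ → Literature.NumberTheory.Sieve.affLinSize Ψ N ≤ L → ∀ K : Set (Fin 1 → ℝ), Convex ℝ K → K ⊆ Literature.NumberTheory.Sieve.realBox 1 N → |Literature.NumberTheory.Sieve.vonMangoldtSum Ψ K N - Literature.NumberTheory.Sieve.archFactor Ψ K * Literature.NumberTheory.Sieve.singularProduct Ψ| ≤ ε * (N : ℝ)) ↔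
    (BoundedDickson → GeneralizedHardyLittlewoodDimOne) :=
  Iff.rfl


/-! ### Intrinsic form of the residual: large pair discriminants -/

/-- **Exact position of the residual, intrinsic form.**  Under `BoundedDickson`, `GeneralizedHardyLittlewoodDimOne`
(stmt-Parity-0819) is EQUIVALENT to its LARGE-DISCRIMINANT residual: for all `t ≥ 1`, `L`, `ε > 0` there are `D`,
`N₀` such that the Hardy–Littlewood error is `≤ ε N` for all `N ≥ N₀`, all non-degenerate `Ψ` with `‖Ψ‖_N ≤ L`
having SOME pair discriminant `|aᵢ bⱼ − aⱼ bᵢ| > D`, and all convex `K ⊆ [−N, N]` — i.e. shift-uniformity is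
open exactly for patterns that spread (pairs `(n, n + h)`, `h → ∞`; Goldbach `(n, M − n)`, `M → ∞`), the regime of
`not_generalizedHardyLittlewoodDimOne_of_unboundedSiegelZeros` (`(n, n + 2q)`, `q → ∞`).  (`→`: restriction;
`←`: bounded discriminants are `uniform_boundedDisc`.) [cite: GreenTao2010, Conj. 1.2 (d = 1)] -/
theorem dimOne_iff_largeDisc (hBD : BoundedDickson) :
    GeneralizedHardyLittlewoodDimOne ↔
      ∀ (t L : ℕ), 1 ≤ t → ∀ ε : ℝ, 0 < ε → ∃ D N₀ : ℕ, ∀ N : ℕ, N₀ ≤ N →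
        ∀ Ψ : Fin t → AffLinForm 1, IsNondegenerateSystem Ψ → affLinSize Ψ N ≤ L →
          (∃ i j, (D : ℤ) < |(Ψ i).coeff 0 * (Ψ j).const - (Ψ j).coeff 0 * (Ψ i).const|) →
          ∀ K : Set (Fin 1 → ℝ), Convex ℝ K → K ⊆ realBox 1 N →
            |vonMangoldtSum Ψ K N - archFactor Ψ K * singularProduct Ψ| ≤ ε * (N : ℝ) := by
  refine ⟨fun hD t L ht ε hε => ?_, fun hRes t L ht ε hε => ?_⟩
  · obtain ⟨N₀, hN₀⟩ := hD t L ht ε hε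
    exact ⟨0, N₀, fun N hN Ψ hΨ hL _ K hK hKN => hN₀ N hN Ψ hΨ hL K hK hKN⟩
  · obtain ⟨D, N₁, hN₁⟩ := hRes t L ht ε hε
    obtain ⟨N₂, hN₂⟩ := uniform_boundedDisc hBD t L D ht ε hε
    refine ⟨max N₁ N₂, fun N hN Ψ hΨ hL K hK hKN => ?_⟩
    by_cases hsmall : ∀ i j, |(Ψ i).coeff 0 * (Ψ j).const - (Ψ j).coeff 0 * (Ψ i).const| ≤ D
    · exact hN₂ N (le_of_max_le_right hN) Ψ hΨ hL hsmall K hK hKN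
    · push Not at hsmall
      obtain ⟨i, j, hij⟩ := hsmall
      exact hN₁ N (le_of_max_le_left hN) Ψ hΨ hL ⟨i, j, hij⟩ K hK hKN

/-- **`stub_shiftLift` ⟺ (`BoundedDickson` → large-discriminant residual)** — the registered stub of
stmt-Parity-18380 (= 13151 → 0819) is, exactly, the statement that fixed-system Dickson–Hardy–Littlewood implies
shift-uniformity for SPREADING patterns. [cite: GreenTao2010, Conj. 1.2 (d = 1)] -/
theorem shiftLift_iff_largeDisc :
    (BoundedDickson → GeneralizedHardyLittlewoodDimOne) ↔
      (BoundedDickson →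
        ∀ (t L : ℕ), 1 ≤ t → ∀ ε : ℝ, 0 < ε → ∃ D N₀ : ℕ, ∀ N : ℕ, N₀ ≤ N →
          ∀ Ψ : Fin t → AffLinForm 1, IsNondegenerateSystem Ψ → affLinSize Ψ N ≤ L →
            (∃ i j, (D : ℤ) < |(Ψ i).coeff 0 * (Ψ j).const - (Ψ j).coeff 0 * (Ψ i).const|) →
            ∀ K : Set (Fin 1 → ℝ), Convex ℝ K → K ⊆ realBox 1 N →
              |vonMangoldtSum Ψ K N - archFactor Ψ K * singularProduct Ψ| ≤ ε * (N : ℝ)) :=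
  ⟨fun h hBD => (dimOne_iff_largeDisc hBD).mp (h hBD), fun h hBD => (dimOne_iff_largeDisc hBD).mpr (h hBD)⟩

end Summit.Parity.GeneralizedHardyLittlewood.TwinLowerDensityToGHLShiftLiftTranslationClass
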